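import Literature.NumberTheory.GaloisRepresentations.IdeleLocalInvariantsRange
import Literature.NumberTheory.GaloisRepresentations.SemiLocalShapiroConjugation
import HarnessLib

/-!
# The local invariants of `H²(Gal(E/F), J_E)` do not depend on the choice of the place `w ∣ v`
# (Tate, C–F VII §7.2: "canonically isomorphic for all `w` over `v`"; Serre XI §1 (iv) transport of structure)

Topic `NumberTheory/GaloisRepresentations`; namespaces `Literature.NumberTheory.GaloisRepresentations.UnitsLayer` (§1–§2) and
`….IdeleCohomology` (§3–§4).  Continues `IdeleLocalInvariantsRange.lean` (`unitsInvAt w`, `localInvAt w`, `localInv E v =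
localInvAt (chosenPlace v)`, `localInvInfAt w₀`, `localInvInf E v`), `SemiLocalShapiroConjugation.lean`
(`groupCohomologyUnitsRepIsoAut_hom_apply_eq_transport`: the Shapiro isomorphisms at `w` and `w' = σw` differ by the
transport along `σ_w : E_w ≃ₐ[F_v] E_{w'}`) and door-c6's `LocalCanonicalFundamentalClassAbstract.lean` (`layerInv K L`,
THE invariant of an abstract layer, defined through a chosen embedding `L ≃ embeddedField K L ⊆ K̄`; `unitsCohomologyIso e n`,
transport of `Hⁿ(Gal(·/K), ·ˣ)` along `e : E₁ ≃ₐ[K] E₂`).  Theorems only (no definition, no named fact, no instance, no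
notation); number fields in `Type`.

Mathematics.  (§1–§2) `layerInv` is invariant under transport of structure: for `e : E₁ ≃ₐ[K] E₂` of finite Galois
layers of a char-0 non-archimedean local field `K`, `inv_{E₂/K} ∘ Hⁿ(e) = inv_{E₁/K}` (`layerInv_unitsCohomologyIso`).
Proof: the embedded copies of `E₁` and `E₂` in `K̄` COINCIDE (normality: `AlgHom.fieldRange_of_normal`), transports
compose (`unitsCohomologyIso_hom_comp`), and the transport along an AUTOMORPHISM `τ ∈ Gal(L/K)` is the identity on
`Hⁿ(Gal(L/K), Lˣ)` — it is the inner automorphism `(g ↦ τ⁻¹gτ, u ↦ τu)` (engine `map_eq_id_of_conj`; Serre VII §5 Prop. 3).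
(§3) Hence, with the Shapiro transport formula, **`unitsInvAt w = unitsInvAt w'` and `localInvAt w = localInvAt w'` for
all `w, w' ∣ v`** (`G` is transitive on the places above `v`), so `localInv E v` is `localInvAt w` for EVERY `w ∣ v` —
Tate's "it is permissible to use the notation `H^r(G^v, (L^v)^*)` for any one of these" [held copy p0217].  (§4) At an
infinite place the same holds for a softer reason: `H²(G, ∏_{w∣v} E_wˣ)` has order `n_v ≤ 2`, and two injective
homomorphisms from a group of order `≤ 2` into `ℚ/ℤ` coincide (`localInvInfAt_eq_of_comap_eq`).

## What is formalised

* §1 `UnitsLayer.unitsCohomologyIso_hom_comp` (`Hⁿ(e) ≫ Hⁿ(e') = Hⁿ(e.trans e')`), `unitsCohomologyIso_self_hom`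
  (`Hⁿ(τ) = 𝟙` for `τ ∈ Gal(L/K)`), `embeddedField_eq_of_algEquiv`.
* §2 **`UnitsLayer.layerInv_unitsCohomologyIso`**: `layerInv K E₂ (Hⁿ(e) x) = layerInv K E₁ x`.
* §3 **`unitsInvAt_eq`**, **`localInvAt_eq`**, `localInv_eq_localInvAt` (finite places).
* §4 `archInvAt_injective`, `addMonoidHom_eq_of_injective_of_natCard` (order ≤ 2 into `ℚ/ℤ`),
  **`localInvInfAt_eq_of_comap_eq`**, `localInvInf_eq_localInvInfAt` (infinite places).

## References
* J. W. S. Cassels, A. Fröhlich (eds.), *Algebraic Number Theory* (1967), Ch. VII (Tate) §7.2, §7.3 Cor. 7.4 (b).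
  [CasselsFrohlichANT1967]
* J.-P. Serre, *Local Fields*, GTM 67 (1979), Ch. VII §5 Prop. 3; Ch. XI §1 (iv); Ch. XIII §3. [SerreLocalFields1979]
-/

noncomputable section

open CategoryTheory groupCohomology Function

namespace Literature.NumberTheory.GaloisRepresentations

/-! ## §1. Transport of `Hⁿ(Gal(E/K), Eˣ)`: composition, automorphisms, the embedded copy -/

namespace UnitsLayer

open Literature.Algebra.Homology
open Literature.AnabelianGeometry.AbsoluteAnabelian.Prop121vii

section Transport

variable {K E₁ E₂ E₃ : Type} [Field K] [Field E₁] [Field E₂] [Field E₃] [Algebra K E₁] [Algebra K E₂] [Algebra K E₃]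

/-- **Transports compose**: `Hⁿ(e) ≫ Hⁿ(e') = Hⁿ(e.trans e')`. [cite: SerreLocalFields1979, Ch. XI §1 (iv)] -/
theorem unitsCohomologyIso_hom_comp (e : E₁ ≃ₐ[K] E₂) (e' : E₂ ≃ₐ[K] E₃) (n : ℕ) :
    (unitsCohomologyIso e n).hom ≫ (unitsCohomologyIso e' n).hom = (unitsCohomologyIso (e.trans e') n).hom := by
  rw [unitsCohomologyIso, unitsCohomologyIso, unitsCohomologyIso, groupCohomology.mapIso_hom,
    groupCohomology.mapIso_hom, groupCohomology.mapIso_hom, ← groupCohomology.map_comp]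
  refine map_congr' ?_ _ _ (fun x => ?_) n
  · refine MonoidHom.ext fun ψ => AlgEquiv.ext fun y => ?_
    simp [AlgEquiv.autCongr_symm, AlgEquiv.autCongr_apply]
  · rfl

/-- Element form of `unitsCohomologyIso_hom_comp`. [cite: SerreLocalFields1979, Ch. XI §1 (iv)] -/
theorem unitsCohomologyIso_hom_apply_apply (e : E₁ ≃ₐ[K] E₂) (e' : E₂ ≃ₐ[K] E₃) (n : ℕ)
    (x : groupCohomology (Rep.ofAlgebraAutOnUnits K E₁) n) :
    (unitsCohomologyIso e' n).hom ((unitsCohomologyIso e n).hom x) = (unitsCohomologyIso (e.trans e') n).hom x := by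
  rw [← unitsCohomologyIso_hom_comp]
  rfl

/-- **The transport along an automorphism `τ ∈ Gal(L/K)` is the identity of `Hⁿ(Gal(L/K), Lˣ)`**: it is the inner
automorphism `(g ↦ τ⁻¹ g τ, u ↦ τ u)` of the pair, which acts trivially (engine `map_eq_id_of_conj`).
[cite: SerreLocalFields1979, Ch. VII §5 Prop. 3] -/
theorem unitsCohomologyIso_self_hom (τ : E₁ ≃ₐ[K] E₁) (n : ℕ) : (unitsCohomologyIso τ n).hom = 𝟙 _ := by
  rw [unitsCohomologyIso, groupCohomology.mapIso_hom]
  refine map_eq_id_of_conj (Rep.ofAlgebraAutOnUnits K E₁) τ (fun ψ => ?_) _ (fun a => ?_) n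
  · apply AlgEquiv.ext
    intro y
    simp [AlgEquiv.autCongr_symm, AlgEquiv.autCongr_apply, AlgEquiv.mul_apply]
  · apply Additive.toMul.injective
    exact Units.ext rfl

end Transport

section Embedded

variable (K : Type) [Field K] {E₁ E₂ : Type} [Field E₁] [Field E₂] [Algebra K E₁] [Algebra K E₂]
  [FiniteDimensional K E₁] [FiniteDimensional K E₂]

/-- **Isomorphic finite Galois extensions have the SAME embedded copy in `K̄`** (the image of a `K`-embedding of a
normal extension does not depend on the embedding: `AlgHom.fieldRange_of_normal`). [cite: SerreLocalFields1979, Ch. XI §1 (iv)] -/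
theorem embeddedField_eq_of_algEquiv [IsGalois K E₁] (e : E₁ ≃ₐ[K] E₂) : embeddedField K E₂ = embeddedField K E₁ := by
  have h := AlgHom.fieldRange_of_normal
    ((embeddingToAbs K E₂).comp (((embeddedEquiv K E₁).symm.trans e : embeddedField K E₁ ≃ₐ[K] E₂) :
      embeddedField K E₁ →ₐ[K] E₂))
  rw [← AlgHom.map_fieldRange, AlgEquiv.fieldRange_eq_top] at h
  exact h

end Embedded

/-! ## §2. `layerInv` is invariant under transport of structure -/

section LayerInv

variable (K : Type) [Field K] [ValuativeRel K] [TopologicalSpace K] [IsNonarchimedeanLocalField K] [CharZero K]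

omit [ValuativeRel K] [TopologicalSpace K] [IsNonarchimedeanLocalField K] in
/-- Transport to two EQUAL embedded layers through two isomorphisms gives the same class in `Br(K)`: after `subst`
the two isomorphisms differ by an automorphism of the layer, whose transport is the identity.
[cite: SerreLocalFields1979, Ch. XI §1 (iv)] -/
theorem unitsInfTwo_unitsCohomologyIso_eq_of_eq {E : Type} [Field E] [Algebra K E]
    {L₁ L₂ : IntermediateField K (AlgebraicClosure K)} (hL : L₁ = L₂)
    [FiniteDimensional K L₁] [IsGalois K L₁] [FiniteDimensional K L₂] [IsGalois K L₂]
    (f₁ : E ≃ₐ[K] L₁) (f₂ : E ≃ₐ[K] L₂) (x : groupCohomology (Rep.ofAlgebraAutOnUnits K E) 2) :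
    unitsInfTwo K L₂ ((unitsCohomologyIso f₂ 2).hom x) = unitsInfTwo K L₁ ((unitsCohomologyIso f₁ 2).hom x) := by
  subst hL
  have ht : f₂ = f₁.trans (f₁.symm.trans f₂) := by
    ext y
    simp
  have key : (unitsCohomologyIso f₂ 2).hom = (unitsCohomologyIso f₁ 2).hom := by
    rw [ht, ← unitsCohomologyIso_hom_comp, unitsCohomologyIso_self_hom, Category.comp_id]
  rw [key]

variable {E₁ E₂ : Type} [Field E₁] [Field E₂] [Algebra K E₁] [Algebra K E₂]
  [FiniteDimensional K E₁] [IsGalois K E₁] [FiniteDimensional K E₂] [IsGalois K E₂]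

/-- **`inv_{E₂/K} ∘ H²(e) = inv_{E₁/K}`** for `e : E₁ ≃ₐ[K] E₂`: door-c6's invariant map of an abstract layer does not
depend on the presentation of the layer (transport of structure). [cite: SerreLocalFields1979, Ch. XI §1 (iv)]
[cite: SerreLocalFields1979, Ch. XIII §3] -/
theorem layerInv_unitsCohomologyIso (e : E₁ ≃ₐ[K] E₂) (x : groupCohomology (Rep.ofAlgebraAutOnUnits K E₁) 2) :
    layerInv K E₂ ((unitsCohomologyIso e 2).hom x) = layerInv K E₁ x := by
  rw [layerInv_apply, layerInv_apply, unitsCohomologyIso_hom_apply_apply]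
  exact congrArg (brauerInvariantEquiv K)
    (unitsInfTwo_unitsCohomologyIso_eq_of_eq K (embeddedField_eq_of_algEquiv K e).symm (embeddedEquiv K E₁)
      (e.trans (embeddedEquiv K E₂)) x)

end LayerInv

end UnitsLayer

/-! ## §3. Finite places: `localInvAt w` does not depend on `w ∣ v` -/

namespace IdeleCohomology

open NumberField IsDedekindDomain Literature.NumberTheory.Automorphic SemiLocal

variable {F : Type} [Field F] [NumberField F] {E : Type} [Field E] [NumberField E] [Algebra F E] [IsGalois F E]
variable {v : HeightOneSpectrum (𝓞 F)}

/-- `unitsInvAt w' = unitsInvAt w` when `σ w = w'` (Shapiro transport + transport-invariance of `layerInv`).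
[cite: CasselsFrohlichANT1967, Ch. VII §7.2] -/
theorem unitsInvAt_eq_of_smul_eq {w w' : Place F E v} {σ : E ≃ₐ[F] E} (h : σ • w = w') :
    unitsInvAt w' = unitsInvAt w := by
  haveI : CharZero (v.adicCompletion F) := charZero_of_injective_algebraMap (algebraMap F _).injective
  haveI := finiteDimensional_place (K := F) w
  haveI := isGalois_place (F := F) w
  haveI := finiteDimensional_place (K := F) w'
  haveI := isGalois_place (F := F) w'
  ext x
  change UnitsLayer.layerInv (v.adicCompletion F) _ ((groupCohomologyUnitsRepIsoAut w' 2).hom x) =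
    UnitsLayer.layerInv (v.adicCompletion F) _ ((groupCohomologyUnitsRepIsoAut w 2).hom x)
  rw [groupCohomologyUnitsRepIsoAut_hom_apply_eq_transport h, UnitsLayer.layerInv_unitsCohomologyIso]

/-- **The block invariant `H²(G, ∏_{w∣v} E_wˣ) → ℚ/ℤ` read at `w` does not depend on `w ∣ v`** (`G` permutes the
places above `v` transitively). [cite: CasselsFrohlichANT1967, Ch. VII §7.2] -/
theorem unitsInvAt_eq (w w' : Place F E v) : unitsInvAt w = unitsInvAt w' := by
  obtain ⟨σ, h⟩ := Place.exists_smul_eq w w'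
  exact (unitsInvAt_eq_of_smul_eq h).symm

/-- **The local invariant `inv_v : H²(Gal(E/F), J_E) → ℚ/ℤ` read at `w` does not depend on `w ∣ v`** (Tate: the groups
`H^r(G_w, L_w^*)`, `w ∣ v`, are canonically isomorphic). [cite: CasselsFrohlichANT1967, Ch. VII §7.2] -/
theorem localInvAt_eq (w w' : Place F E v) : localInvAt w = localInvAt w' := by
  ext c
  rw [localInvAt_eq_unitsInvAt, localInvAt_eq_unitsInvAt, unitsInvAt_eq w w']

/-- `localInv E v = localInvAt w` for EVERY place `w ∣ v` (not only the chosen one).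
[cite: CasselsFrohlichANT1967, Ch. VII §7.2] -/
theorem localInv_eq_localInvAt (w : Place F E v) : localInv E v = localInvAt w :=
  localInvAt_eq _ w

/-- `inv_v(c) = 0 ↔` the component of `c` at `v` vanishes — for the canonical `localInv`.
[cite: CasselsFrohlichANT1967, Ch. VII §7.3 Cor. 7.4 (b)] -/
theorem localInv_eq_zero_iff (v : HeightOneSpectrum (𝓞 F)) (c : groupCohomology (IdeleClassGroup.ideleRep F E) 2) :
    localInv E v c = 0 ↔ groupCohomology.map (MonoidHom.id (E ≃ₐ[F] E)) (placeProj v) 2 c = 0 :=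
  localInvAt_eq_zero_iff _ c

/-! ## §4. Infinite places: `localInvInfAt w₀` depends only on `w₀|_F` -/

/-- `archInvAt w₀` is injective. [cite: CasselsFrohlichANT1967, Ch. VII §7.3 Cor. 7.4 (b)] -/
theorem archInvAt_injective (w₀ : InfinitePlace E) : Function.Injective (archInvAt (F := F) w₀) :=
  (archLayerInv_injective (F := F) w₀).comp (ArchHerbrand.groupCohomologyArchUnitsRepIso w₀ 2).toLinearEquiv.injective

/-- The non-zero `2`-torsion element of `ℚ/ℤ` is `1/2`. [cite: SerreLocalFields1979, Ch. XIII §3 Cor. 2 to Prop. 7] -/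
theorem eq_zmodToQmodZ_two_one {t : AddCircle (1 : ℚ)} (ht : 2 • t = 0) (ht0 : t ≠ 0) :
    t = Literature.AnabelianGeometry.AbsoluteAnabelian.Prop121vii.zmodToQmodZ 2 1 := by
  obtain ⟨k, rfl⟩ := UnitsLayer.mem_range_zmodToQmodZ_of_nsmul_eq_zero 2 t ht
  have hk : k ≠ 0 := fun h => ht0 (by rw [h, map_zero])
  have hk1 : k = 1 := by
    fin_cases k
    · exact absurd rfl hk
    · rfl
  rw [hk1]

/-- **Two injective homomorphisms from a group of order `1` or `2` into `ℚ/ℤ` coincide** (a non-zero element goes to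
the unique element `1/2` of order `2`). [cite: CasselsFrohlichANT1967, Ch. VII §7.3 Cor. 7.4 (b)] -/
theorem addMonoidHom_eq_of_injective_of_natCard {A : Type} [AddCommGroup A] (hA : Nat.card A = 1 ∨ Nat.card A = 2)
    {φ ψ : A →+ AddCircle (1 : ℚ)} (hφ : Function.Injective φ) (hψ : Function.Injective ψ) : φ = ψ := by
  ext a
  by_cases ha : a = 0
  · rw [ha, map_zero, map_zero]
  rcases hA with h1 | h2
  · haveI := (Nat.card_eq_one_iff_unique.mp h1).1
    exact absurd (Subsingleton.elim a 0) ha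
  · have h2a : (2 : ℕ) • a = 0 := by
      rw [← h2]
      exact card_nsmul_eq_zero'
    have hφa := eq_zmodToQmodZ_two_one (t := φ a) (by rw [← map_nsmul, h2a, map_zero])
      (fun h => ha (hφ (h.trans (map_zero φ).symm)))
    have hψa := eq_zmodToQmodZ_two_one (t := ψ a) (by rw [← map_nsmul, h2a, map_zero])
      (fun h => ha (hψ (h.trans (map_zero ψ).symm)))
    rw [hφa, hψa]

/-- `localInvInfAt w₀` factors through the component at `v = w₀|_F` by an injective map, uniformly in `v`
(the dependent-type bookkeeping for the next theorem). [cite: CasselsFrohlichANT1967, Ch. VII §7.3 Cor. 7.4 (b)] -/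
theorem exists_localInvInfAt_eq_comp (v : InfinitePlace F) (w₀ : InfinitePlace E)
    (hw : w₀.comap (algebraMap F E) = v) :
    ∃ φ : groupCohomology (ArchHerbrand.archUnitsRep (E := E) v) 2 →+ AddCircle (1 : ℚ),
      Function.Injective φ ∧ ∀ c : groupCohomology (IdeleClassGroup.ideleRep F E) 2,
        localInvInfAt (F := F) w₀ c = φ (groupCohomology.map (MonoidHom.id (E ≃ₐ[F] E)) (infPlaceProj v) 2 c) := by
  subst hw
  exact ⟨archInvAt w₀, archInvAt_injective w₀, fun c => localInvInfAt_eq_archInvAt w₀ c⟩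

/-- **At an infinite place the local invariant read at `w₀` depends only on `v = w₀|_F`**: two places `w₀, w₁` above
the same `v` give the same `inv_v` (the summand `H²(G, ∏_{w∣v} E_wˣ)` has order `n_v ∈ {1, 2}`, and injective maps
from such a group to `ℚ/ℤ` are unique). [cite: CasselsFrohlichANT1967, Ch. VII §7.2][cite: CasselsFrohlichANT1967, Ch. VII §7.3 Cor. 7.4 (b)] -/
theorem localInvInfAt_eq_of_comap_eq {w₀ w₁ : InfinitePlace E}
    (h : w₀.comap (algebraMap F E) = w₁.comap (algebraMap F E)) :
    localInvInfAt (F := F) w₀ = localInvInfAt (F := F) w₁ := by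
  obtain ⟨φ₀, hφ₀, h₀⟩ := exists_localInvInfAt_eq_comp (w₁.comap (algebraMap F E)) w₀ h
  obtain ⟨φ₁, hφ₁, h₁⟩ := exists_localInvInfAt_eq_comp (w₁.comap (algebraMap F E)) w₁ rfl
  have hA : Nat.card (groupCohomology (ArchHerbrand.archUnitsRep (E := E) (w₁.comap (algebraMap F E))) 2) = 1 ∨
      Nat.card (groupCohomology (ArchHerbrand.archUnitsRep (E := E) (w₁.comap (algebraMap F E))) 2) = 2 := by
    rw [Nat.card_congr (ArchHerbrand.groupCohomologyArchUnitsRepIso (F := F) w₁ 2).toLinearEquiv.toEquiv]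
    exact ArchHerbrand.natCard_H2_archLocalUnitsRep_eq_one_or_two (F := F) w₁
  have hφ : φ₀ = φ₁ := addMonoidHom_eq_of_injective_of_natCard hA hφ₀ hφ₁
  ext c
  rw [h₀ c, h₁ c, hφ]

/-- `localInvInf E v = localInvInfAt w₀` for EVERY place `w₀ ∣ v` (not only the chosen `placeOver E v`).
[cite: CasselsFrohlichANT1967, Ch. VII §7.2] -/
theorem localInvInf_eq_localInvInfAt {v : InfinitePlace F} {w₀ : InfinitePlace E} (h : ArchHerbrand.IsOver E v w₀) :
    localInvInf E v = localInvInfAt (F := F) w₀ :=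
  localInvInfAt_eq_of_comap_eq ((ArchHerbrand.isOver_placeOver (E := E) v).trans h.symm)

end IdeleCohomology

end Literature.NumberTheory.GaloisRepresentations

end
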